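import Mathlib
import HarnessLib
import Summits.ValiantsHypothesis.ValiantsHypothesis.Theses.MonotoneRestoration
import Literature.Computability.AlgebraicComplexity.ArithCircuit
import Literature.Computability.AlgebraicComplexity.ArithCircuitProofs
import Literature.Computability.AlgebraicComplexity.MonotoneStructure
import Literature.Computability.AlgebraicComplexity.PermanentIrreducible
import Literature.ModelTheory.FiniteModelTheory.CkEquiv
import Summits.ValiantsHypothesis.ValiantsHypothesis.Theorems.MonotoneRestorationMonotoneRestorationQPCosetCount
import Summits.ValiantsHypothesis.ValiantsHypothesis.Theorems.MonotoneRestorationMonotoneRestorationQPSymmetricLB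
import Summits.ValiantsHypothesis.ValiantsHypothesis.Theorems.MonotoneRestorationMonotoneRestorationQPSupportSymmetrisation
import Summits.ValiantsHypothesis.ValiantsHypothesis.Theorems.MonotoneRestorationMonotoneRestorationQPSparseRegime
import Summits.ValiantsHypothesis.ValiantsHypothesis.Theorems.MonotoneRestorationMonotoneRestorationQPBeta
import Literature.Computability.AlgebraicComplexity.SymmetricArithCircuit
import Literature.Computability.AlgebraicComplexity.DawarWilsenach2025Proofs
import Literature.GroupTheory.PermutationGroups.SmallIndexSubgroups
import Summits.ValiantsHypothesis.ValiantsHypothesis.Theorems.MonotoneRestorationQP.Negative.LoadBearing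
import Summits.ValiantsHypothesis.ValiantsHypothesis.Theorems.MonotoneRestorationMonotoneRestorationQPPermSupportCount

/-! TTRL-lite variant V19856 of stmt-ValiantsHypothesis-15886 -/

-- `ValiantsHypothesis.ValiantsHypothesis`: the D-0017 layout repeats the problem name in the path.
set_option linter.dupNamespace false

namespace Summit.ValiantsHypothesis.ValiantsHypothesis.Theorems

open Summit.ValiantsHypothesis.ValiantsHypothesis.Theses.MonotoneRestoration
open Literature.Computability.AlgebraicComplexity

/-- TTRL-lite variant V19856 of `stub_mulGate_children_extend` (pair form through divisibility):
over `ℝ≥0`, if `p * q ∣ g`, `g ≠ 0` and `g` extends by a monomial shift into the support of `f`,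
then every cross monomial `m + m'` (`m ∈ supp p`, `m' ∈ supp q`) extends into the support of `f`
by one common shift. Proof: write `g = p * q * r` with `r ≠ 0`, pick `m₀ ∈ supp r`; over `ℝ≥0`
supports of products are Minkowski sums (`add_mem_support_mul`), so `m + m' + m₀ ∈ supp g`, and
the shift `m₀ + μ` works. [folklore] -/
theorem stub_mulGate_children_extend_var19856 :
    ∀ (n : ℕ) (p q g f : MvPolynomial (Fin n × Fin n) NNReal), g ≠ 0 → p * q ∣ g →
      (∃ μ : (Fin n × Fin n) →₀ ℕ, ∀ m ∈ g.support, m + μ ∈ f.support) →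
      ∃ μ : (Fin n × Fin n) →₀ ℕ, ∀ m ∈ p.support, ∀ m' ∈ q.support,
        m + m' + μ ∈ f.support := by
  intro n p q g f hg hdvd hext
  obtain ⟨μ, hμ⟩ := hext
  obtain ⟨r, rfl⟩ := hdvd
  have hr : r ≠ 0 := by
    rintro rfl
    exact hg (mul_zero _)
  obtain ⟨m₀, hm₀⟩ := MvPolynomial.support_nonempty.2 hr
  refine ⟨m₀ + μ, fun m hm m' hm' => ?_⟩
  have hmg : m + m' + m₀ ∈ (p * q * r).support :=
    add_mem_support_mul (add_mem_support_mul hm hm') hm₀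
  have := hμ _ hmg
  simpa only [add_assoc] using this

end Summit.ValiantsHypothesis.ValiantsHypothesis.Theorems
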